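import Literature.MathematicalPhysics.QuantumFieldTheory.Balaban1983to89.B9Thm34GFinal

/-!
# `Balaban1983to89.B9Thm34GUniformR1` — [Balaban1985BackgroundPropagators] THEOREM 3.4 p. 400, THE `G(U′U)`-CLAUSE with the constants chosen
# before the lattice (r06 FILE 46 `B9Thm34GUniform`), RESTATED WITH THE [4] LEMMA 2.1 INPUTS ASKED ONLY FOR THE EXPONENTS THE PROOF USES:
# `9/5000 ≤ α` instead of `0 < α` in the two Lemma-2.1 binders («R1» of the pub-ymgap N06 row-13 lineage, seat dag-n06-c gen 3/4;
# statement-only change, proof verbatim)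

statement-level skeleton of published theorems with citation tags; proofs where landed; nothing here is a claim about the Yang–Mills mass gap

CITATION HEADER (lean-in-tree rule).  B9 = T. Bałaban, *Propagators for lattice gauge theories in a background field*, Commun. Math. Phys.
**99** (1985) 389–434 [Balaban1985BackgroundPropagators] (held `paper:balaban1985-cmp99-background-propagators`; journal page = PDF page + 388):
Theorem 3.4 p. 400 [PDF 12] L7–10 «There exists a positive constant a₁ such that the operators G′(U), (Q′(U)G′²(U)Q′*(U))⁻¹, R(U), G(U) extend
to configurations U′U for α₁ ≦ a₁ as analytic functions of A. The extended operators satisfy all the inequalities of Theorems 3.1–3.3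
correspondingly»; Theorem 3.1 p. 397 [PDF 9] «There exist positive constants M₁, δ₀, a₀, B₀ dependent on d and L only»; Theorem 3.3 p. 399
[PDF 11] «Under the assumptions of Theorem 3.1, and with the constants described there»; p. 399 L1–3 «Let us stress that the constants in
the formulations of both theorems do not depend on the sequence {Ω_j}, j = 0, 1, …, k, if the conditions (2.1), (2.2) are satisfied»;
p. 402 [PDF 14] L23 «We assume that Theorem 3.1 is valid for the operator G′(U)»; p. 403 [PDF 15] L5–7 «of course with different constants,
although changes are small. We define new constants in such a way that the statements of Theorem 3.1 hold for extended operators»;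
p. 407 [PDF 19] (3.84)–(3.86) «for α₁ sufficiently small the series is convergent»; Thm 3.1 (3.42) p. 397, Thm 3.2 (3.48) p. 398, p. 398
remark after (3.47) «Using Lemma 2.1 in [4] we may replace the factor (Lʲη)^α by (Lʲη)^β(L^{j′}η)^γ with β + γ = α»; (3.15)/(3.19)/(3.21)/
(3.24)/(3.25) pp. 393–394; (3.57) p. 401, (3.58)–(3.65) p. 402, (3.65)bis–(3.68) p. 403; (3.76)–(3.77) pp. 405–406; (3.80)–(3.86) p. 407;
(3.35)/(3.37) p. 396.  [4] = [Balaban1984PropagatorsII] Lemma 2.1 p. 234 [PDF 12] («For the numbers α, 0 < α < 1, c₁(α) = 12c₀(½α), and RM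
satisfying (2.59)» — (2.60)–(2.61) with the absolute series c₀, c₁ and the δ₀ of (2.48): no dependence on the torus, k or {Ω_j}),
(2.51)–(2.55) p. 232, (2.61)/(2.66) p. 234.  [B11] = [Balaban1985Variational] (135) p. 298.  Rows B9.Thm3.4 × B9.Thm3.2 × B9.Thm3.3 ×
B9.Eq3.83 × B9.Eq3.62 × B9.Eq3.66 × B9.Eq3.85 (cells only; no row head changes).  (2.59) p. 233 [PDF 11]: «Now we require that RM is sufficiently large, i.e. we assume
¼αδ₀RM > 2d log c₀(½α) + 1. (2.59)».

WHY THIS FILE (pub-ymgap N06 row 13, dag-n06-c LOCATED-4, pub-ymgap INBOX 2026-08-27 ≈01:47Z/02:01Z; sibling of `…B9Thm34SectBUniformR1`, whose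
header states the case in full).  r06's FILE 46 hypothesises [4] Lemma 2.1 in the shape «for EVERY 0 < α < 1» (`h261 : ∀ α, 0 < α → α < 1 →
Ineq261 d 𝔅 δ₀ α`, `hST : ∀ α, 0 < α → ScaleTransfer …`) with no trace of the printed size condition (2.59), whose M-threshold grows without
bound as α → 0 — FALSE over every multiscale family with unboundedly many scales at fixed M, although the proof USES the two binders at the
literal exponents 1/100, 9/5000, 33/10000, 49/5000, 1/10, 3/5 only.  THIS FILE is FILE 46 with the two binder texts `0 < α → α < 1 → Ineq261 …`
⟶ `9 / 5000 ≤ α → α < 1 → Ineq261 …` and `0 < α → ScaleTransfer …` ⟶ `9 / 5000 ≤ α → ScaleTransfer …` and NOTHING ELSE changed (proof byte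
for byte; the side goals `0 < c` become `9/5000 ≤ c`, closed by the same `norm_num`).  Count-neutral, supersedable by an in-place edit of the
r06 chain.

WHAT IS PROVED (0 `def`, 0 sorry, 0 new named facts; standard axioms) — FILE 46's theorem under the same short name in the namespace
`…B9Thm34GUniformR1`:
* **`thm34_G_clause_uniform`** — `C⁻¹(U′U)` and `G(U′U)` exist as two-sided inverses of `Q′(U′U)G′²(U′U)Q′*(U′U)` and of the concrete
  `Δ_a(U′U)` of (3.82)–(3.84); every left entry `X·G(U) ≺ B₀·P·e^{−δ₀d}` transfers to `X·G(U′U) ≺ B·P·e^{−(δ₀/6)d}` and every right entry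
  `G(U)·Y ≺ B₀(Lʲη)e^{−δ₀d}` to `G(U′U)·Y ≺ B(Lʲη)e^{−(δ₀/6)d}`; quantifier order `∃ a₁ > 0 ∃ B ≧ 0 ∀ S T U g blk … (axioms, [4] (2.61) FOR
  9/5000 ≦ α < 1, scale transfer FOR 9/5000 ≦ α with the given Λ(·), commuting translations, unitary-type U, (3.35), stencil geometry, (3.60)
  data, Theorem 3.1 for G′(U), (3.19) letters + section, Theorem 3.2 for U, (3.15)/(3.24) letters, Theorem 3.3 for G(U) in block-majorant AND
  kernel form) ∀ α₁ ≦ a₁ ∀ A kF sF … ∀ (3.57)/(3.59) letters ∀ (3.80)–(3.82) letters`.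

PROOF.  r06's FILE 46 proof verbatim (FILE 19 `B9Thm34GConcreteC.thm34_G_clause_concreteC` at FILE 20's cascade; `ineq261_rescale`,
`scaleTransfer_rescale`, `exists_threshold_of_continuousAt`, `neumann_le_two` of `B9Thm34GFinal`).

HONEST SCOPE / NOT CLAIMED.  As FILE 46 (Theorems 3.1–3.3 FOR `U` are inputs; letters as block-majorant / kernel hypotheses of the printed
shape; Hölder/L² entries not covered; the rate `δ₀/6` one admissible choice).  The kernel-form hypotheses `hGk`/`hDGk`/`hGDk`/`hDGDk` for
`G(U)` are INHERITED from FILE 46 unchanged; the lit-balaban desk (pub-ymgap ME #13, 2026-08-26) records that a block-uniform pointwise kernel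
bound of that shape is NOT satisfied by Bałaban's own propagators on multi-point blocks for d ≥ 3 — they stay hypotheses of an implication
here, and the N06 frames v2 use this theorem only through conclusions that do not depend on them being sharp.  The ONLY difference to FILE 46
is the weaker Lemma-2.1 hypothesis; 9/5000 is a proof constant of the r06 chain, not a printed number.  Nothing of [B9] is asserted; no row
head changes; NOT a node discharge; nothing continuum / OS / mass-gap / Clay.

RELATED IN THE TREE, NOT DUPLICATED: FILE 46 `B9Thm34GUniform` (the «∀ 0 < α < 1» statement; kept — it has importers), FILE 20 `B9Thm34GFinal`,
FILE 19 `B9Thm34GConcreteC.thm34_G_clause_concreteC`, `B9Ineq385VG.ineq383_op` USED BY NAME; no existing module modified.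
-/


noncomputable section

namespace Literature.MathematicalPhysics.QuantumFieldTheory.Balaban1983to89.B9Thm34GUniformR1

open NormedSpace Complex
open Literature.MathematicalPhysics.QuantumFieldTheory.Balaban1983to89
open Literature.MathematicalPhysics.QuantumFieldTheory.Balaban1983to89.B6RandomWalk (HasMajorant hasMajorant_mono Triangle254 Ineq261)
open Literature.MathematicalPhysics.QuantumFieldTheory.Balaban1983to89.B6RandomWalkHom (HasMajorantHom)
open Literature.MathematicalPhysics.QuantumFieldTheory.Balaban1983to89.B9Thm34Ext (toB6)
open Literature.MathematicalPhysics.QuantumFieldTheory.Balaban1983to89.B9Ineq347 (ScaleTransfer)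
open Literature.MathematicalPhysics.QuantumFieldTheory.Balaban1983to89.B9Eq386Neumann (pTwo deltaA)
open Literature.MathematicalPhysics.QuantumFieldTheory.Balaban1983to89.B9Ineq377POne (kappa377 kappa377_nonneg)
open Literature.MathematicalPhysics.QuantumFieldTheory.Balaban1983to89.B9Ineq385VG (kappa383 kappa383_nonneg kappa385 kappa385_nonneg ineq383_op)
open Literature.MathematicalPhysics.QuantumFieldTheory.Balaban1983to89.B9Eq39Adjoint
open Literature.MathematicalPhysics.QuantumFieldTheory.Balaban1983to89.B9Eq369Small (Through)
open Literature.MathematicalPhysics.QuantumFieldTheory.Balaban1983to89.B9Eq372Locality (stBonds)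
open Literature.MathematicalPhysics.QuantumFieldTheory.Balaban1983to89.B9Eq352DivForm (tauF tauB)
open Literature.MathematicalPhysics.QuantumFieldTheory.Balaban1983to89.B9Eq352DivFormLetters
open Literature.MathematicalPhysics.QuantumFieldTheory.Balaban1983to89.B9Eq352GradLetters (diffLetter)
open Literature.MathematicalPhysics.QuantumFieldTheory.Balaban1983to89.B9Eq371GradLetters (bT bU)
open Literature.MathematicalPhysics.QuantumFieldTheory.Balaban1983to89.B9Eq372RemLetters (lapDDLetter)
open Literature.MathematicalPhysics.QuantumFieldTheory.Balaban1983to89.B9Eq382V3Letters (dPrimeLetter)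
open Literature.MathematicalPhysics.QuantumFieldTheory.Balaban1983to89.B9Eq376POneLetters (conjHom gradLin divLin)
open Literature.MathematicalPhysics.QuantumFieldTheory.Balaban1983to89.B9Ineq385V3Concrete (cV385 cV385_nonneg)
open Literature.MathematicalPhysics.QuantumFieldTheory.Balaban1983to89.B9Ineq368PPrime (kappa349 kappa368)
open Literature.MathematicalPhysics.QuantumFieldTheory.Balaban1983to89.B9Ineq368PPrimeDs (kappa368Ds kappa368Ds_nonneg kappa368_nonneg kappa349_nonneg)
open Literature.MathematicalPhysics.QuantumFieldTheory.Balaban1983to89.B9Eq360Vprime (gPrimeExtEnd)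
open Literature.MathematicalPhysics.QuantumFieldTheory.Balaban1983to89.B9Eq360VprimeLetters (vPrimeConc cBConc cCConc)
open Literature.MathematicalPhysics.QuantumFieldTheory.Balaban1983to89.B9Ineq363Vprime (cVConc cVConc_nonneg theta363 thetaL363 theta363_nonneg
  thetaL363_nonneg)
open Literature.MathematicalPhysics.QuantumFieldTheory.Balaban1983to89.B9Ineq366CPrime (kappa366 kappa366_nonneg kappa366_pos)
open Literature.MathematicalPhysics.QuantumFieldTheory.Balaban1983to89.B6RandomWalkSection (secExt secRes secConj)
open Literature.MathematicalPhysics.QuantumFieldTheory.Balaban1983to89.B9Thm34GConcreteC (thm34_G_clause_concreteC)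
open Literature.MathematicalPhysics.QuantumFieldTheory.Balaban1983to89.B6RandomWalk (c1_nonneg)
open Literature.MathematicalPhysics.QuantumFieldTheory.Balaban1983to89.B9Thm34GFinal (ineq261_rescale scaleTransfer_rescale c1_pos_of_ineq261
  exists_threshold_of_continuousAt neumann_le_two)

/-! ## Theorem 3.4, `G`-clause: `a₁`, `B` chosen before the lattice -/

section Uniform

variable {𝔸 : Type*} [NormedRing 𝔸] [NormedAlgebra ℂ 𝔸] [CompleteSpace 𝔸] {ι : Type} [Fintype ι]
variable (b : Module.Basis ι ℝ 𝔸) (κ : Type) [Fintype κ] [LinearOrder κ]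

set_option maxHeartbeats 800000 in
/-- **THEOREM 3.4, `G`-CLAUSE (with the `(Q′G′²Q′*)⁻¹`-clause), CONCRETE PERTURBATION, CONSTANTS BEFORE THE LATTICE** («There exists a
positive constant a₁ such that the operators G′(U), (Q′(U)G′²(U)Q′*(U))⁻¹, R(U), G(U) extend to configurations U′U for α₁ ≦ a₁ as analytic
functions of A. The extended operators satisfy all the inequalities of Theorems 3.1–3.3 correspondingly», p. 400; «the constants … do not
depend on the sequence {Ω_j}», p. 399; «of course with different constants», p. 403), for the `G(U′U)`-part: for fixed `d`, direction type
`κ`, algebra `(𝔸, b)` with real-coordinate constant `M₂`, input constants `δ₀, B₀, κ_Q, B_G, B₁, c_F, C_q, a₀, C₀, d₀, κ_Qb, c_Fb, ā` and ONE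
scale-transfer function `Λ(·) ≧ 1` (p. 398 / [4] Lemma 2.1), `∃ a₁ > 0 ∃ B ≧ 0` such that FOR EVERY lattice `(S, T)`, geometry `𝔅 = g`
with block map `blk`, background `U`, (3.15)/(3.19)/(3.24)/(3.60) data and operators `G′(U)`, `C⁻¹(U)`, `G(U)` obeying Theorems 3.1–3.3 at
the rate `δ₀` (FILE 20's hypotheses verbatim, the scale transfer with the given `Λ(α)`), for all `0 ≦ α₁ ≦ a₁`, `A` in (3.37) (blockwise),
`∀` (3.57)/(3.59)/(3.80)–(3.81) letters of size `O(1)α₁`: `C⁻¹(U′U)` and `G(U′U)` exist (two-sided inverses of `Q′(U′U)G′²(U′U)Q′*(U′U)`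
and of the concrete `Δ_a(U′U)` of (3.82)–(3.84)) and every left/right (3.42)-entry of Theorem 3.3 transfers from `G(U)` at `(B₀, δ₀)` to
`G(U′U)` at `(B, δ₀/6)`.  (`a₁`, `B` = FILE 20's values read at `Λ(1/100)`, `Λ(9/5000)`, `Λ(33/10000)`, `Λ(1/10)`.) (R1: [4] Lemma 2.1 (2.61) and the p. 398 scale transfer are hypothesised for the exponents
`9/5000 ≦ α` only — the ones the proof uses — instead of r06's «every 0 < α < 1»; nothing else differs from FILE 46.)
[cite: Balaban1985BackgroundPropagators, Thm 3.4 p.400 + p.399 + p.402 + p.403 + p.407 + Thm 3.1 (3.42) p.397 + Thm 3.2 (3.48) p.398 + Thm 3.3 p.399 + p.398 remark + (3.15)/(3.19)/(3.21)/(3.24)/(3.25) pp.393–394 + (3.57) p.401 + (3.58)–(3.65) p.402 + (3.65)bis–(3.67) p.403 + (3.68) p.403 + (3.76)–(3.77) pp.405–406 + (3.80)–(3.86) p.407 + (3.35)/(3.37) p.396; Balaban1984PropagatorsII, Lemma 2.1 p.234 + (2.51)–(2.55) p.232 + (2.66) p.234; Balaban1985Variational, (135) p.298] -/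
theorem thm34_G_clause_uniform [DecidableEq ι] (d : ℕ)
    (δ₀ B₀ κQ BG B₁ cF Cq a₀ C₀ d₀ M₂ κQb cFb abar : ℝ) (Λf : ℝ → ℝ)
    (hB₀ : 0 ≤ B₀) (hκQ : 0 < κQ) (hBG : 0 < BG) (hB₁ : 0 < B₁) (hcF : 0 < cF) (hCq : 0 ≤ Cq) (ha₀ : 0 ≤ a₀) (hC₀ : 0 ≤ C₀)
    (hM₂ : 0 ≤ M₂) (hδ₀ : 0 < δ₀) (hκQb : 0 ≤ κQb) (hcFb : 0 ≤ cFb) (habar : 0 ≤ abar) (hΛf : ∀ α : ℝ, 0 < α → 1 ≤ Λf α)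
    (hrepr : ∀ (v : 𝔸) (i : ι), |b.repr v i| ≤ M₂ * ‖v‖) :
    ∃ a₁ : ℝ, 0 < a₁ ∧ ∃ B : ℝ, 0 ≤ B ∧
    ∀ {S : Type} [Fintype S] [DecidableEq S] (T : κ → Equiv.Perm S) (U : κ → S → 𝔸ˣ)
      {g : B9.Geometry} [Fintype g.Site] [DecidableEq g.Site] [Nonempty g.Site] {Rr : ℝ} {H : Prop} (blk : S → g.Site)
      (kQ : g.Site → S → 𝔸 →L[ℝ] 𝔸) (sQ : S → 𝔸 →L[ℝ] 𝔸) (cfun w : g.Site → ℝ)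
    -- the multiscale geometry 𝔅 (p. 393, [4] (2.1)–(2.4)) and its axioms
    (hdnn : ∀ a a' : g.Site, 0 ≤ g.dist a a') (htri : Triangle254 (toB6 g Rr H)) (hrefl : ∀ y : g.Site, g.dist y y = 0)
    (hsym : ∀ y y' : g.Site, g.dist y y' = g.dist y' y) (hlen : ∀ y : g.Site, 0 < g.len y) (hlenη : ∀ y : g.Site, g.eta ≤ g.len y)
    (hη : 0 < g.eta) (hL : 1 ≤ g.L)
    -- [4] Lemma 2.1 (2.61) at the rate `δ₀`, for every exponent `9/5000 ≤ α < 1` (R1: the exponents the proof uses; print: «0 < α < 1» with (2.59))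
    (h261 : ∀ α : ℝ, 9 / 5000 ≤ α → α < 1 → Ineq261 d (toB6 g Rr H) δ₀ α)
    -- p. 398: «Using Lemma 2.1 in [4] we may replace the factor (Lʲη)^α by (Lʲη)^β(L^{j′}η)^γ with β + γ = α» — for every exponent
    -- `9/5000 ≤ α` (R1), one constant `Λ(α) ≧ 1` for the six weights `(Lʲη)^{1,2,−1,−2,−4}` (natural and real powers)
      (hST : ∀ α : ℝ, 9 / 5000 ≤ α → ScaleTransfer g δ₀ α (Λf α) (fun a => g.len a) ∧ ScaleTransfer g δ₀ α (Λf α) (fun a => g.len a ^ 2) ∧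
        ScaleTransfer g δ₀ α (Λf α) (fun a => (g.len a)⁻¹) ∧ ScaleTransfer g δ₀ α (Λf α) (fun a => (g.len a ^ 2)⁻¹) ∧
        ScaleTransfer g δ₀ α (Λf α) (fun a => (g.len a ^ 4)⁻¹) ∧ ScaleTransfer g δ₀ α (Λf α) (fun y => g.len y ^ (-(4 : ℝ))))
    -- real coordinates of `𝔸`, commuting translations, unitary-type background
    (hT : ∀ (μ ν : κ) (x : S), T μ (T ν x) = T ν (T μ x))
    (hU1 : ∀ m z, ‖((U m z : 𝔸ˣ) : 𝔸)‖ ≤ 1 ∧ ‖(((U m z)⁻¹ : 𝔸ˣ) : 𝔸)‖ ≤ 1)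
    -- (3.35) on the plaquettes through each bond, at that bond's block scale; stencil geometry at range `d₀`
    (h35 : ∀ μ x m n y, Through T μ x m n y → ‖(plaqU T U m n y : 𝔸) - 1‖ ≤ C₀ * ((g.L ^ g.scale (blk x))⁻¹) ^ 2)
    (hd₀B : ∀ μ x, g.dist (blk x) (blk ((T μ).symm x)) ≤ d₀) (hd₀F : ∀ μ x, g.dist (blk x) (blk (T μ x)) ≤ d₀)
    (hd₀FB : ∀ μ ν x, g.dist (blk x) (blk ((T ν).symm (T μ x))) ≤ d₀)
    (hd₀st : ∀ μ x (q : κ × S), q ∈ stBonds T μ x → g.dist (blk x) (blk q.2) ≤ d₀)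
    (hd₀loc : ∀ μ x (q : κ × S), q ∈ B9Eq375Locality.locBondsA' T μ x → g.dist (blk x) (blk q.2) ≤ d₀)
    (hd₀0 : ∀ y : g.Site, g.dist y y ≤ d₀)
    -- the `A`-independent data of the concrete `V′(A)` of (3.60): (3.19) kernels/multipliers and the `a`-weights of (3.24)
    (hw : ∀ y, 0 ≤ w y) (hcard : ∀ y, ((B9Eq360Vprime.block blk y).card : ℝ) * w y ≤ 1)
    (hkQ : ∀ y x, blk x = y → ‖kQ y x‖ ≤ w y) (hsQ : ∀ x, ‖sQ x‖ ≤ 1) (hcfun : ∀ y, |cfun y| ≤ a₀ * (g.len y ^ 2)⁻¹)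
    -- THEOREM 3.1 for `G′(U)`: (3.42)₁,₂,₃ at the rate `δ₀`
    {Gp : Module.End ℝ (S × ι → ℝ)}
    (h342_1 : HasMajorant (g := toB6 g Rr H) (fun p : S × ι => blk p.1) Gp
      (fun a a' => BG * g.len a ^ 2 * Real.exp (-(δ₀ * g.dist a a'))))
    (h342_2 : ∀ k : κ ⊕ κ, HasMajorant (g := toB6 g Rr H) (fun p : S × ι => blk p.1)
      (conj b (diffLetter T U ((g.eta : ℂ)⁻¹) k) * Gp) (fun a a' => BG * g.len a * Real.exp (-(δ₀ * g.dist a a'))))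
    (h342_3 : ∀ k : κ ⊕ κ, HasMajorant (g := toB6 g Rr H) (fun p : S × ι => blk p.1)
      (Gp * conj b (diffLetter T U ((g.eta : ℂ)⁻¹) k)) (fun a a' => BG * g.len a * Real.exp (-(δ₀ * g.dist a a'))))
    -- the (3.19) letters `Q′(U)`, `Q′*(U)` in their own typing with block-local two-space majorants, a section of the block map (FILE 17)
    (rep : g.Site → S × ι) (hrep : ∀ y : g.Site, blk (rep y).1 = y)
    {Qc : (S × ι → ℝ) →ₗ[ℝ] (g.Site → ℝ)} {Qcs : (g.Site → ℝ) →ₗ[ℝ] (S × ι → ℝ)} {Linv : Module.End ℝ (g.Site → ℝ)}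
    (hQc : HasMajorantHom (g := toB6 g Rr H) (fun p : S × ι => blk p.1) (fun y : g.Site => y) Qc
      (fun a a' : g.Site => κQ * (if a = a' then (1 : ℝ) else 0)))
    (hQcs : HasMajorantHom (g := toB6 g Rr H) (fun y : g.Site => y) (fun p : S × ι => blk p.1) Qcs
      (fun a a' : g.Site => κQ * (if a = a' then (1 : ℝ) else 0)))
    -- THEOREM 3.2 for `U`: (3.21) `C⁻¹ = (Q′G′²Q′*)⁻¹` exists (`hLinv`) with the KERNEL bound (3.48) at the rate `δ₀`
    (hLinv : (Qc ∘ₗ (Gp * Gp) ∘ₗ Qcs) * Linv = 1)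
    (h348 : ∀ y y' : g.Site, |B9Thm34Inv.ker (B9Thm34Inv.vol g d) Linv y y'| ≤
      B₁ * g.len y ^ (-(4 : ℝ)) * g.len y' ^ (-(d : ℝ)) * Real.exp (-(δ₀ * g.dist y y')))
    -- the (3.15) bond letters `Q(U)`, `Q*(U)` and the weight letter `a` of (3.24)/(3.26), with their majorants
    {G Qs Q a : Module.End ℝ ((κ × S) × ι → ℝ)}
    (hQb : HasMajorant (g := toB6 g Rr H) (fun q : (κ × S) × ι => blk q.1.2) Q (fun a a' => κQb * Real.exp (-(δ₀ * g.dist a a'))))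
    (hQsb : HasMajorant (g := toB6 g Rr H) (fun q : (κ × S) × ι => blk q.1.2) Qs (fun a a' => κQb * Real.exp (-(δ₀ * g.dist a a'))))
    (ha324 : HasMajorant (g := toB6 g Rr H) (fun q : (κ × S) × ι => blk q.1.2) a
      (fun a a' : g.Site => if a = a' then abar * (g.len a ^ 2)⁻¹ else 0))
    -- THEOREM 3.3 for `G(U)`: two-sided inverse of the concrete `Δ_a(U)` and its (3.42)-entries at the rate `δ₀`
    (hΔG : deltaA (conj b (lapDDLetter T ((g.eta : ℂ)⁻¹) U)) (conj b (dPrimeLetter T U g.eta))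
      (conjHom b (gradLin T ((g.eta : ℂ)⁻¹) U) ∘ₗ (1 - (Gp ∘ₗ Qcs ∘ₗ Linv ∘ₗ Qc ∘ₗ Gp)) ∘ₗ conjHom b (divLin T ((g.eta : ℂ)⁻¹) U)) Qs a Q * G = 1)
    (hGΔ : G * deltaA (conj b (lapDDLetter T ((g.eta : ℂ)⁻¹) U)) (conj b (dPrimeLetter T U g.eta))
      (conjHom b (gradLin T ((g.eta : ℂ)⁻¹) U) ∘ₗ (1 - (Gp ∘ₗ Qcs ∘ₗ Linv ∘ₗ Qc ∘ₗ Gp)) ∘ₗ conjHom b (divLin T ((g.eta : ℂ)⁻¹) U)) Qs a Q = 1)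
    (hG : HasMajorant (g := toB6 g Rr H) (fun q : (κ × S) × ι => blk q.1.2) G
      (fun a a' => B₀ * g.len a ^ 2 * Real.exp (-(δ₀ * g.dist a a'))))
    (hDG : ∀ k : κ ⊕ κ, HasMajorant (g := toB6 g Rr H) (fun q : (κ × S) × ι => blk q.1.2)
      (conj b (diffLetter (bT T) (bU U) ((g.eta : ℂ)⁻¹) k) * G) (fun a a' => B₀ * g.len a * Real.exp (-(δ₀ * g.dist a a'))))
    (hGD : ∀ k : κ ⊕ κ, HasMajorant (g := toB6 g Rr H) (fun q : (κ × S) × ι => blk q.1.2)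
      (G * conj b (diffLetter (bT T) (bU U) ((g.eta : ℂ)⁻¹) k)) (fun a a' => B₀ * g.len a * Real.exp (-(δ₀ * g.dist a a')))),
    ∀ (α₁ : ℝ), 0 ≤ α₁ → α₁ ≤ a₁ →
    -- the exponent field `A` in the domain (3.37), read blockwise in the shapes of FILES 1–19, and the `A`-dependent (3.59) data `kF`, `sF`
    ∀ (A : κ → S → 𝔸) (kF : g.Site → S → 𝔸 →L[ℝ] 𝔸) (sF : S → 𝔸 →L[ℝ] 𝔸),
      (∀ y x, blk x = y → ‖kF y x‖ ≤ Cq * α₁ * w y) → (∀ x, ‖sF x‖ ≤ Cq * α₁) →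
      (∀ ν k x, ‖((g.eta : ℂ)⁻¹) • covDstar T U ν (A k) x‖ ≤ α₁ * (g.len (blk x) ^ 2)⁻¹) →
      (∀ μ ν x, ‖((g.eta : ℂ)⁻¹) • covD T U μ (A ν) x‖ ≤ α₁ * (g.len (blk x) ^ 2)⁻¹) →
      (∀ μ ν x, ‖((g.eta : ℂ)⁻¹) • covDstar T U ν (A ν) (T μ x)‖ ≤ α₁ * (g.len (blk x) ^ 2)⁻¹) →
      (∀ μ x, ‖((g.eta : ℂ)⁻¹) • covDstar T U μ (tauB T U μ (A μ)) x‖ ≤ α₁ * (g.len (blk x) ^ 2)⁻¹) →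
      (∀ μ ν k x, ‖((g.eta : ℂ)⁻¹) • covD T U μ (A k) ((T ν).symm x)‖ ≤ α₁ * (g.len (blk x) ^ 2)⁻¹) →
      (∀ k x, ‖A k x‖ ≤ α₁ * (g.len (blk x))⁻¹) → (∀ ν k x, ‖tauB T U ν (A k) x‖ ≤ α₁ * (g.len (blk x))⁻¹) →
      (∀ μ k x, ‖tauF T U μ (A k) x‖ ≤ α₁ * (g.len (blk x))⁻¹) →
      (∀ k μ ν x, ‖A k ((T ν).symm (T μ x))‖ ≤ α₁ * (g.len (blk x))⁻¹) →
      (∀ μ x m z, (m, z) ∈ stBonds T μ x → ‖A m z‖ ≤ α₁ * (g.len (blk x))⁻¹) →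
      (∀ μ x m z, (m, z) ∈ B9Eq375Locality.locBondsA T μ x → ‖A m z‖ ≤ α₁ * (g.len (blk x))⁻¹) →
      (∀ μ x m n y, Through T μ x m n y →
        ‖covD T U m (A n) y‖ ≤ g.eta * (α₁ * ((g.len (blk x))⁻¹) ^ 2) ∧ ‖covD T U n (A m) y‖ ≤ g.eta * (α₁ * ((g.len (blk x))⁻¹) ^ 2)) →
    -- the (3.57)/(3.59) letters `F′₂(A)`, `F′₂*(A)` (block-local, size `c_F α₁`)
    ∀ {Qc' Fc : (S × ι → ℝ) →ₗ[ℝ] (g.Site → ℝ)} {Qcs' Fcs : (g.Site → ℝ) →ₗ[ℝ] (S × ι → ℝ)},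
      Qc' = Qc + Fc → Qcs' = Qcs + Fcs →
      HasMajorantHom (g := toB6 g Rr H) (fun p : S × ι => blk p.1) (fun y : g.Site => y) Fc
        (fun a a' : g.Site => cF * α₁ * (if a = a' then (1 : ℝ) else 0)) →
      HasMajorantHom (g := toB6 g Rr H) (fun y : g.Site => y) (fun p : S × ι => blk p.1) Fcs
        (fun a a' : g.Site => cF * α₁ * (if a = a' then (1 : ℝ) else 0)) →
    -- the (3.80)–(3.81) letters `F₂(A)`, `F₂*(A)` («|F₂(A)|, |F₂*(A)| ≦ O(1)α₁»), `P₂(A)` of (3.82)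
    ∀ {P₂ Qs' Q' F₂ F₂s : Module.End ℝ ((κ × S) × ι → ℝ)},
      Q' = Q + F₂ → Qs' = Qs + F₂s → P₂ = pTwo Qs Q F₂ F₂s a →
      HasMajorant (g := toB6 g Rr H) (fun q : (κ × S) × ι => blk q.1.2) F₂ (fun a a' => cFb * α₁ * Real.exp (-(δ₀ * g.dist a a'))) →
      HasMajorant (g := toB6 g Rr H) (fun q : (κ × S) × ι => blk q.1.2) F₂s (fun a a' => cFb * α₁ * Real.exp (-(δ₀ * g.dist a a'))) →
    ∃ (Tinv : Module.End ℝ (g.Site → ℝ)) (GExt : Module.End ℝ ((κ × S) × ι → ℝ)),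
      Tinv * (Qc' ∘ₗ ((gPrimeExtEnd Gp (conj b (vPrimeConc T U g.eta A blk kQ kF sQ sF cfun) * Gp)) * (gPrimeExtEnd Gp (conj b (vPrimeConc T U g.eta A blk kQ kF sQ sF cfun) * Gp))) ∘ₗ Qcs') = 1 ∧
      (Qc' ∘ₗ ((gPrimeExtEnd Gp (conj b (vPrimeConc T U g.eta A blk kQ kF sQ sF cfun) * Gp)) * (gPrimeExtEnd Gp (conj b (vPrimeConc T U g.eta A blk kQ kF sQ sF cfun) * Gp))) ∘ₗ Qcs') * Tinv = 1 ∧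
      deltaA (conj b (lapDDLetter T ((g.eta : ℂ)⁻¹) (prodCfg U g.eta A)))
          (conj b (dPrimeLetter T (prodCfg U g.eta A) g.eta))
          (conjHom b (gradLin T ((g.eta : ℂ)⁻¹) (prodCfg U g.eta A)) ∘ₗ (1 - ((Gp ∘ₗ Qcs ∘ₗ Linv ∘ₗ Qc ∘ₗ Gp) + (B9Eq360Vprime.pPrime Gp (gPrimeExtEnd Gp (conj b (vPrimeConc T U g.eta A blk kQ kF sQ sF cfun) * Gp)) (Qcs ∘ₗ secRes rep) (Qcs' ∘ₗ secRes rep) (secConj rep Linv) (secConj rep Tinv) (secExt rep ∘ₗ Qc) (secExt rep ∘ₗ Qc'))))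
            ∘ₗ conjHom b (divLin T ((g.eta : ℂ)⁻¹) (prodCfg U g.eta A))) Qs' a Q' * GExt = 1 ∧
      GExt *
      deltaA (conj b (lapDDLetter T ((g.eta : ℂ)⁻¹) (prodCfg U g.eta A)))
          (conj b (dPrimeLetter T (prodCfg U g.eta A) g.eta))
          (conjHom b (gradLin T ((g.eta : ℂ)⁻¹) (prodCfg U g.eta A)) ∘ₗ (1 - ((Gp ∘ₗ Qcs ∘ₗ Linv ∘ₗ Qc ∘ₗ Gp) + (B9Eq360Vprime.pPrime Gp (gPrimeExtEnd Gp (conj b (vPrimeConc T U g.eta A blk kQ kF sQ sF cfun) * Gp)) (Qcs ∘ₗ secRes rep) (Qcs' ∘ₗ secRes rep) (secConj rep Linv) (secConj rep Tinv) (secExt rep ∘ₗ Qc) (secExt rep ∘ₗ Qc'))))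
            ∘ₗ conjHom b (divLin T ((g.eta : ℂ)⁻¹) (prodCfg U g.eta A))) Qs' a Q' = 1 ∧
      (∀ (X : Module.End ℝ ((κ × S) × ι → ℝ)) (P : g.Site → ℝ), (∀ y, 0 ≤ P y) →
        HasMajorant (g := toB6 g Rr H) (fun q : (κ × S) × ι => blk q.1.2) (X * G)
          (fun a a' => B₀ * P a * Real.exp (-(δ₀ * g.dist a a'))) →
        HasMajorant (g := toB6 g Rr H) (fun q : (κ × S) × ι => blk q.1.2) (X * GExt)
          (fun a a' => B * P a * Real.exp (-(δ₀ / 6 * g.dist a a')))) ∧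
      (∀ Y : Module.End ℝ ((κ × S) × ι → ℝ),
        HasMajorant (g := toB6 g Rr H) (fun q : (κ × S) × ι => blk q.1.2) (G * Y)
          (fun a a' => B₀ * g.len a * Real.exp (-(δ₀ * g.dist a a'))) →
        HasMajorant (g := toB6 g Rr H) (fun q : (κ × S) × ι => blk q.1.2) (GExt * Y)
          (fun a a' => B * g.len a * Real.exp (-(δ₀ / 6 * g.dist a a')))) := by
  classical
  have hSb : 0 ≤ ∑ i, ‖b i‖ := Finset.sum_nonneg fun i _ => norm_nonneg _
  -- the four scale-transfer constants of the cascade, READ FROM THE GIVEN FUNCTION `Λ(·)` (lattice-free), under the names of FILE 20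
  obtain ⟨Λ, hΛ, hΛeq⟩ : ∃ Λ : ℝ, 1 ≤ Λ ∧ Λf (1 / 100) = Λ := ⟨_, hΛf _ (by norm_num), rfl⟩
  obtain ⟨Λρ, hΛρ1, hΛρeq⟩ : ∃ Λρ : ℝ, 1 ≤ Λρ ∧ Λf (1 / 100 * (9 / 50)) = Λρ := ⟨_, hΛf _ (by norm_num), rfl⟩
  obtain ⟨Λρ₁, hΛρ₁1, hΛρ₁eq⟩ : ∃ Λρ₁ : ℝ, 1 ≤ Λρ₁ ∧ Λf (1 / 100 * (33 / 100)) = Λρ₁ := ⟨_, hΛf _ (by norm_num), rfl⟩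
  obtain ⟨c₄, hc₄1, hc₄eq⟩ : ∃ c₄ : ℝ, 1 ≤ c₄ ∧ Λf (1 / 10) = c₄ := ⟨_, hΛf _ (by norm_num), rfl⟩
  have hΛ0 : 0 < Λ := zero_lt_one.trans_le hΛ
  have hΛρ : 0 ≤ Λρ := zero_le_one.trans hΛρ1
  have hΛρ₁ : 0 ≤ Λρ₁ := zero_le_one.trans hΛρ₁1
  have hc₄ : 0 < c₄ := zero_lt_one.trans_le hc₄1
  have hBnn : 0 ≤ 2 * B₀ * Λρ ^ 2 * B6.c1 d (9 / 50 * δ₀) (1 / 100) := mul_nonneg (mul_nonneg (mul_nonneg zero_le_two hB₀) (sq_nonneg Λρ)) (c1_nonneg _ _ _)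
  -- «for α₁ sufficiently small» (pp. 402, 403, 407): the five threshold functions of FILES 1–19 are CONTINUOUS AT `α₁ = 0` and vanish there — NO lattice datum enters
  obtain ⟨ε₁, hε₁, hF1⟩ := exists_threshold_of_continuousAt
    (f := fun α₁ : ℝ => theta363 (Fintype.card κ) 1 α₁ a₀ Cq M₂ (∑ i, ‖b i‖) (Real.exp (δ₀ * d₀)) BG Λ (B6.c1 d δ₀ (1 / 100)) * B6.c1 d (49 / 50 * δ₀) (1 / 100))
    (by unfold theta363 kappa385 cVConc cBConc; fun_prop) (by simp [theta363])
  obtain ⟨ε₂, hε₂, hF2⟩ := exists_threshold_of_continuousAt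
    (f := fun α₁ : ℝ => theta363 (Fintype.card κ) 1 α₁ a₀ Cq M₂ (∑ i, ‖b i‖) (Real.exp (7 / 20 * δ₀ * d₀)) BG Λ (B6.c1 d δ₀ (1 / 100)) * B6.c1 d (33 / 100 * δ₀) (1 / 100))
    (by unfold theta363 kappa385 cVConc cBConc; fun_prop) (by simp [theta363])
  obtain ⟨ε₃, hε₃, hF3⟩ := exists_threshold_of_continuousAt
    (f := fun α₁ : ℝ => thetaL363 (Fintype.card κ) 1 α₁ a₀ Cq M₂ (∑ i, ‖b i‖) (Real.exp (7 / 20 * δ₀ * d₀)) BG Λ (B6.c1 d δ₀ (1 / 100)) * B6.c1 d (33 / 100 * δ₀) (1 / 100))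
    (by unfold thetaL363 kappa385 cVConc cBConc; fun_prop) (by simp [thetaL363])
  obtain ⟨ε₄, hε₄, hF4⟩ := exists_threshold_of_continuousAt
    (f := fun α₁ : ℝ => kappa385 B₀ (cV385 (Fintype.card κ) α₁ C₀ ((M₂ * ∑ i, ‖b i‖) * Real.exp (1 / 5 * δ₀ * d₀)) + ∑ _k : κ ⊕ κ, (10 + 8 * ↑(Fintype.card κ) + (16 * ↑(Fintype.card κ) + 12) * C₀) * ((M₂ * ∑ i, ‖b i‖) * Real.exp (1 / 5 * δ₀ * d₀))) (kappa377 (4 * (1 + ↑(Fintype.card κ)) * (M₂ * ∑ i, ‖b i‖) * Real.exp (1 / 4 * δ₀ * d₀)) (kappa349 κQ ((1 + ↑(Fintype.card κ)) * BG) B₁ Λ (B6.c1 d δ₀ (1 / 100))) (kappa368 κQ cF (kappa385 1 (cVConc (Fintype.card κ) 1 α₁ a₀ Cq M₂ (∑ i, ‖b i‖) (Real.exp (7 / 20 * δ₀ * d₀))) 0 0 Λ (B6.c1 d δ₀ (1 / 100))) (kappa366 κQ cF (kappa385 1 (cVConc (Fintype.card κ) 1 α₁ a₀ Cq M₂ (∑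 i, ‖b i‖) (Real.exp (δ₀ * d₀))) 0 0 Λ (B6.c1 d δ₀ (1 / 100))) BG (BG * B6.c1 d (49 / 50 * δ₀) (1 / 100) * (1 - theta363 (Fintype.card κ) 1 α₁ a₀ Cq M₂ (∑ i, ‖b i‖) (Real.exp (δ₀ * d₀)) BG Λ (B6.c1 d δ₀ (1 / 100)) * B6.c1 d (49 / 50 * δ₀) (1 / 100))⁻¹) Λ (B6.c1 d δ₀ (1 / 100)) α₁) BG BG (BG * B6.c1 d (33 / 100 * δ₀) (1 / 100) * (1 - theta363 (Fintype.card κ) 1 α₁ a₀ Cq M₂ (∑ i, ‖b i‖) (Real.exp (7 / 20 * δ₀ * d₀)) BG Λ (B6.c1 d δ₀ (1 / 100)) * B6.c1 d (33 / 100 * δ₀) (1 / 100))⁻¹) B₁ (2 * B₁ * B6.c1 d ((1 / 2 - 1 / 10) * δ₀) (1 / 10)) Λ (B6.c1 d δ₀ (1 / 100)) α₁ + ↑(Fintype.card κ) * kappa368Ds κQ cF (kappa385 BG (cVConc (Fintype.card κ) 1 α₁ a₀ Cq M₂ (∑ i, ‖b i‖) (Real.exp (7 / 20 * δ₀ * d₀)))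 0 0 Λ (B6.c1 d δ₀ (1 / 100))) (kappa366 κQ cF (kappa385 1 (cVConc (Fintype.card κ) 1 α₁ a₀ Cq M₂ (∑ i, ‖b i‖) (Real.exp (δ₀ * d₀))) 0 0 Λ (B6.c1 d δ₀ (1 / 100))) BG (BG * B6.c1 d (49 / 50 * δ₀) (1 / 100) * (1 - theta363 (Fintype.card κ) 1 α₁ a₀ Cq M₂ (∑ i, ‖b i‖) (Real.exp (δ₀ * d₀)) BG Λ (B6.c1 d δ₀ (1 / 100)) * B6.c1 d (49 / 50 * δ₀) (1 / 100))⁻¹) Λ (B6.c1 d δ₀ (1 / 100)) α₁) BG BG BG (B6.c1 d (33 / 100 * δ₀) (1 / 100) * (1 - theta363 (Fintype.card κ) 1 α₁ a₀ Cq M₂ (∑ i, ‖b i‖) (Real.exp (7 / 20 * δ₀ * d₀)) BG Λ (B6.c1 d δ₀ (1 / 100)) * B6.c1 d (33 / 100 * δ₀) (1 / 100))⁻¹) (BG * Λρ₁ ^ 2 * B6.c1 d (33 / 100 * δ₀) (1 / 100) * (1 - thetaL363 (Fintype.card κ) 1 α₁ a₀ Cq M₂ (∑ i, ‖b i‖)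 (Real.exp (7 / 20 * δ₀ * d₀)) BG Λ (B6.c1 d δ₀ (1 / 100)) * B6.c1 d (33 / 100 * δ₀) (1 / 100))⁻¹) B₁ (2 * B₁ * B6.c1 d ((1 / 2 - 1 / 10) * δ₀) (1 / 10)) (cBConc (Fintype.card κ) M₂ (∑ i, ‖b i‖) (Real.exp (B9Ineq368Vprime.rateC (1 / 100) (33 / 100 * δ₀) * d₀))) (cCConc (Fintype.card κ) 1 α₁ a₀ Cq M₂ (∑ i, ‖b i‖) (Real.exp (B9Ineq368Vprime.rateC (1 / 100) (33 / 100 * δ₀) * d₀))) Λ (B6.c1 d δ₀ (1 / 100)) α₁) Λ (B6.c1 d δ₀ (1 / 100)) α₁) (kappa383 κQb cFb abar Λ (B6.c1 d δ₀ (1 / 100)) α₁) Λ (B6.c1 d δ₀ (1 / 100)) * α₁ * B6.c1 d (9 / 50 * δ₀) (1 / 100))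
    (by
      unfold theta363 thetaL363 kappa368 kappa368Ds kappa377 kappa366 kappa349 kappa383 kappa385 cV385 B9Eq382V3Letters.cV0
        B9Eq373V3.kΔ B9Eq373V3.kP cCConc cVConc cBConc
      fun_prop (disch := simp))
    (by simp)
  obtain ⟨ε₅, hε₅, hF5⟩ := exists_threshold_of_continuousAt
    (f := fun α₁ : ℝ => α₁ * (2 * (kappa366 κQ cF (kappa385 1 (cVConc (Fintype.card κ) 1 α₁ a₀ Cq M₂ (∑ i, ‖b i‖) (Real.exp (δ₀ * d₀))) 0 0 Λ (B6.c1 d δ₀ (1 / 100))) BG (BG * B6.c1 d (49 / 50 * δ₀) (1 / 100) * (1 - theta363 (Fintype.card κ) 1 α₁ a₀ Cq M₂ (∑ i, ‖b i‖) (Real.exp (δ₀ * d₀)) BG Λ (B6.c1 d δ₀ (1 / 100)) * B6.c1 d (49 / 50 * δ₀) (1 / 100))⁻¹) Λ (B6.c1 d δ₀ (1 / 100)) α₁ * B₁ * c₄ * B6.c1 d δ₀ (1 / 2 + 1 / 10)) * B6.c1 d ((1 / 2 - 1 / 10) * δ₀) (1 / 10)))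
    (by
      unfold theta363 kappa366 kappa385 cVConc cBConc
      fun_prop (disch := simp))
    (by simp)
  -- the threshold `a₁` and the `α₁`-independent constant `B`
  refine ⟨min (min (min ε₁ ε₂) (min ε₃ ε₄)) (min ε₅ (1 / 2)) / 2,
    half_pos (lt_min (lt_min (lt_min hε₁ hε₂) (lt_min hε₃ hε₄)) (lt_min hε₅ one_half_pos)), 2 * B₀ * Λρ ^ 2 * B6.c1 d (9 / 50 * δ₀) (1 / 100),
    hBnn, ?_⟩
  -- NOW the lattice, the background, the letters and Theorems 3.1–3.3 for `U`
  intro S _ _ T U g _ _ _ Rr H blk kQ sQ cfun w hdnn htri hrefl hsym hlen hlenη hη hL h261 hST hT hU1 h35 hd₀B hd₀F hd₀FB hd₀st hd₀loc hd₀0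
    hw hcard hkQ hsQ hcfun Gp h342_1 h342_2 h342_3 rep hrep Qc Qcs Linv hQc hQcs hLinv h348 G Qs Q a hQb hQsb ha324 hΔG hGΔ hG hDG hGD
    α₁ hα₁0 hα₁1 A kF sF hkF hsF h337B h337F h337B' h337Bτ h337FB hA hAτB hAτF hAFB hAst hAloc hdAst Qc' Fc Qcs' Fcs h357 h357s hFc hFcs P₂ Qs' Q' F₂ F₂s h380 h380s hP₂def hF₂ hF₂s
  obtain ⟨y₀⟩ := ‹Nonempty g.Site›
  -- the p. 398 scale transfers at the exponents of the cascade, for THIS lattice, from the uniform hypothesis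
  obtain ⟨hT1, hT2, hT1i, hT2i, hT4, -⟩ := hST (1 / 100) (by norm_num)
  obtain ⟨hTρ0, -, -, -, -, -⟩ := hST (1 / 100 * (9 / 50)) (by norm_num)
  obtain ⟨hTρ₁0, -, -, -, -, -⟩ := hST (1 / 100 * (33 / 100)) (by norm_num)
  obtain ⟨-, -, -, -, -, hT4v⟩ := hST (1 / 10) (by norm_num)
  rw [hΛeq] at hT1 hT2 hT1i hT2i hT4
  rw [hΛρeq] at hTρ0
  rw [hΛρ₁eq] at hTρ₁0
  rw [hc₄eq] at hT4v
  have hTρ : ScaleTransfer g (9 / 50 * δ₀) (1 / 100) Λρ (fun a => g.len a) := scaleTransfer_rescale hTρ0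
  have hTρ₁ : ScaleTransfer g (33 / 100 * δ₀) (1 / 100) Λρ₁ (fun a => g.len a) := scaleTransfer_rescale hTρ₁0
  -- [4] Lemma 2.1 at the six (rate, exponent) pairs of the cascade, all read from the one printed rate `δ₀` (§1)
  have h261β : Ineq261 d (toB6 g Rr H) δ₀ (1 / 100) := h261 _ (by norm_num) (by norm_num)
  have h261' : Ineq261 d (toB6 g Rr H) (9 / 50 * δ₀) (1 / 100) :=
    ineq261_rescale (h261 (1 / 100 * (9 / 50)) (by norm_num) (by norm_num))
  have h261'' : Ineq261 d (toB6 g Rr H) (33 / 100 * δ₀) (1 / 100) :=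
    ineq261_rescale (h261 (1 / 100 * (33 / 100)) (by norm_num) (by norm_num))
  have h261c : Ineq261 d (toB6 g Rr H) (49 / 50 * δ₀) (1 / 100) :=
    ineq261_rescale (h261 (1 / 100 * (49 / 50)) (by norm_num) (by norm_num))
  have h261v : Ineq261 d (toB6 g Rr H) δ₀ (1 / 2 + 1 / 10) := h261 _ (by norm_num) (by norm_num)
  have h261v' : Ineq261 d (toB6 g Rr H) ((1 / 2 - 1 / 10) * δ₀) (1 / 10) :=
    ineq261_rescale (h261 (1 / 10 * (1 / 2 - 1 / 10)) (by norm_num) (by norm_num))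
  -- `c₁ > 0` at these pairs (non-empty 𝔅)
  have hc₂ : 0 < B6.c1 d δ₀ (1 / 100) := c1_pos_of_ineq261 h261β y₀ (hrefl y₀)
  have hc' : 0 < B6.c1 d (9 / 50 * δ₀) (1 / 100) := c1_pos_of_ineq261 h261' y₀ (hrefl y₀)
  have hc'' : 0 < B6.c1 d (33 / 100 * δ₀) (1 / 100) := c1_pos_of_ineq261 h261'' y₀ (hrefl y₀)
  have hcc' : 0 < B6.c1 d (49 / 50 * δ₀) (1 / 100) := c1_pos_of_ineq261 h261c y₀ (hrefl y₀)
  have hc₁v : 0 < B6.c1 d δ₀ (1 / 2 + 1 / 10) := c1_pos_of_ineq261 h261v y₀ (hrefl y₀)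
  have hc₁v' : 0 < B6.c1 d ((1 / 2 - 1 / 10) * δ₀) (1 / 10) := c1_pos_of_ineq261 h261v' y₀ (hrefl y₀)
  -- the 24 linear side conditions of the cascade
  have hr : 9 / 50 * δ₀ + (1 / 100 + 1 / 100) * δ₀ ≤ 1 / 5 * δ₀ := by linarith only [hδ₀]
  have hrP : 1 / 5 * δ₀ + 2 * ((1 / 100 + 1 / 100) * δ₀) ≤ 1 / 4 * δ₀ := by linarith only [hδ₀]
  have hrG : 1 / 4 * δ₀ + (2 * (1 / 100) + 1 / 100) * δ₀ ≤ 7 / 20 * δ₀ := by linarith only [hδ₀]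
  have hr1 : 33 / 100 * δ₀ + (1 / 100 + 1 / 100) * δ₀ ≤ 7 / 20 * δ₀ := by linarith only [hδ₀]
  have hr368 : 1 / 4 * δ₀ + 2 * ((2 * (1 / 100) + 1 / 100) * δ₀) ≤ B9Ineq368Vprime.rateC (1 / 100) (33 / 100 * δ₀) := by
    unfold B9Ineq368Vprime.rateC; linarith only [hδ₀]
  have hrc1 : 49 / 50 * δ₀ + (1 / 100 + 1 / 100) * δ₀ ≤ δ₀ := by linarith only [hδ₀]
  have hrc : δ₀ / 2 + (1 / 100 + 1 / 100) * δ₀ ≤ (1 - 1 / 100) * (49 / 50 * δ₀) := by linarith only [hδ₀]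
  have hrcG : 7 / 20 * δ₀ + (1 / 100 + 1 / 100) * δ₀ ≤ (1 - 1 / 100) * (49 / 50 * δ₀) := by linarith only [hδ₀]
  have hGδ1 : 7 / 20 * δ₀ ≤ δ₀ := by linarith only [hδ₀]
  have hrCinv : 7 / 20 * δ₀ ≤ (1 - 1 / 10) * ((1 / 2 - 1 / 10) * δ₀) := by linarith only [hδ₀]
  have hρ0 : 0 ≤ 9 / 50 * δ₀ := by linarith only [hδ₀]
  have hδ5 : 0 ≤ 1 / 5 * δ₀ := by linarith only [hδ₀]
  have hρ₁0 : 0 ≤ 33 / 100 * δ₀ := by linarith only [hδ₀]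
  have hρc0 : 0 ≤ 49 / 50 * δ₀ := by linarith only [hδ₀]
  have hα''ρ : 0 ≤ (1 - 1 / 100) * (33 / 100 * δ₀) := by linarith only [hδ₀]
  have hα''ρ2 : 0 ≤ (1 - 2 * (1 / 100)) * (33 / 100 * δ₀) := by linarith only [hδ₀]
  have hα''ρ3 : 0 ≤ (1 - 3 * (1 / 100)) * (33 / 100 * δ₀) := by linarith only [hδ₀]
  have hα'ρ0 : 0 ≤ 1 / 100 * (9 / 50 * δ₀) := by linarith only [hδ₀]
  have hα'ρ2 : 0 ≤ (1 - 2 * (1 / 100)) * (9 / 50 * δ₀) := by linarith only [hδ₀]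
  have hrb : 1 / 5 * δ₀ + (1 / 100 + 1 / 100) * δ₀ ≤ δ₀ := by linarith only [hδ₀]
  have hΛρ2 : 1 ≤ Λρ ^ 2 := one_le_pow₀ hΛρ1
  have hB₀c : 0 ≤ B₀ * B6.c1 d (9 / 50 * δ₀) (1 / 100) := mul_nonneg hB₀ hc'.le
  have hB2 : B₀ * B6.c1 d (9 / 50 * δ₀) (1 / 100) * 2 ≤ 2 * B₀ * Λρ ^ 2 * B6.c1 d (9 / 50 * δ₀) (1 / 100) :=
    calc B₀ * B6.c1 d (9 / 50 * δ₀) (1 / 100) * 2 = 2 * (B₀ * B6.c1 d (9 / 50 * δ₀) (1 / 100)) * 1 := by ring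
      _ ≤ 2 * (B₀ * B6.c1 d (9 / 50 * δ₀) (1 / 100)) * Λρ ^ 2 := mul_le_mul_of_nonneg_left hΛρ2 (mul_nonneg zero_le_two hB₀c)
      _ = 2 * B₀ * Λρ ^ 2 * B6.c1 d (9 / 50 * δ₀) (1 / 100) := by ring
  have hB3 : B₀ * Λρ ^ 2 * B6.c1 d (9 / 50 * δ₀) (1 / 100) * 2 ≤ 2 * B₀ * Λρ ^ 2 * B6.c1 d (9 / 50 * δ₀) (1 / 100) := le_of_eq (by ring)
  have hmε₁ : min (min (min ε₁ ε₂) (min ε₃ ε₄)) (min ε₅ (1 / 2)) ≤ ε₁ := (min_le_left _ _).trans ((min_le_left _ _).trans (min_le_left _ _))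
  have hmε₂ : min (min (min ε₁ ε₂) (min ε₃ ε₄)) (min ε₅ (1 / 2)) ≤ ε₂ := (min_le_left _ _).trans ((min_le_left _ _).trans (min_le_right _ _))
  have hmε₃ : min (min (min ε₁ ε₂) (min ε₃ ε₄)) (min ε₅ (1 / 2)) ≤ ε₃ := (min_le_left _ _).trans ((min_le_right _ _).trans (min_le_left _ _))
  have hmε₄ : min (min (min ε₁ ε₂) (min ε₃ ε₄)) (min ε₅ (1 / 2)) ≤ ε₄ := (min_le_left _ _).trans ((min_le_right _ _).trans (min_le_right _ _))
  have hmε₅ : min (min (min ε₁ ε₂) (min ε₃ ε₄)) (min ε₅ (1 / 2)) ≤ ε₅ := (min_le_right _ _).trans (min_le_left _ _)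
  have hmh : min (min (min ε₁ ε₂) (min ε₃ ε₄)) (min ε₅ (1 / 2)) ≤ 1 / 2 := (min_le_right _ _).trans (min_le_right _ _)
  have habs : |α₁| = α₁ := abs_of_nonneg hα₁0
  have h1 : theta363 (Fintype.card κ) 1 α₁ a₀ Cq M₂ (∑ i, ‖b i‖) (Real.exp (δ₀ * d₀)) BG Λ (B6.c1 d δ₀ (1 / 100)) * B6.c1 d (49 / 50 * δ₀) (1 / 100) < 1 / 2 := hF1 α₁ (by rw [habs]; linarith only [hα₁1, hmε₁, hε₁])
  have h2 : theta363 (Fintype.card κ) 1 α₁ a₀ Cq M₂ (∑ i, ‖b i‖) (Real.exp (7 / 20 * δ₀ * d₀)) BG Λ (B6.c1 d δ₀ (1 / 100)) * B6.c1 d (33 / 100 * δ₀) (1 / 100) < 1 / 2 := hF2 α₁ (by rw [habs]; linarith only [hα₁1, hmε₂, hε₂])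
  have h3 : thetaL363 (Fintype.card κ) 1 α₁ a₀ Cq M₂ (∑ i, ‖b i‖) (Real.exp (7 / 20 * δ₀ * d₀)) BG Λ (B6.c1 d δ₀ (1 / 100)) * B6.c1 d (33 / 100 * δ₀) (1 / 100) < 1 / 2 := hF3 α₁ (by rw [habs]; linarith only [hα₁1, hmε₃, hε₃])
  have h4 : kappa385 B₀ (cV385 (Fintype.card κ) α₁ C₀ ((M₂ * ∑ i, ‖b i‖) * Real.exp (1 / 5 * δ₀ * d₀)) + ∑ _k : κ ⊕ κ, (10 + 8 * ↑(Fintype.card κ) + (16 * ↑(Fintype.card κ) + 12) * C₀) * ((M₂ * ∑ i, ‖b i‖) * Real.exp (1 / 5 * δ₀ * d₀))) (kappa377 (4 * (1 + ↑(Fintype.card κ)) * (M₂ * ∑ i, ‖b i‖) * Real.exp (1 / 4 * δ₀ * d₀)) (kappa349 κQ ((1 + ↑(Fintype.card κ)) * BG) B₁ Λ (B6.c1 d δ₀ (1 / 100))) (kappa368 κQ cF (kappa385 1 (cVConc (Fintype.card κ) 1 α₁ a₀ Cq M₂ (∑ i, ‖b i‖) (Real.exp (7 / 20 * δ₀ *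 d₀))) 0 0 Λ (B6.c1 d δ₀ (1 / 100))) (kappa366 κQ cF (kappa385 1 (cVConc (Fintype.card κ) 1 α₁ a₀ Cq M₂ (∑ i, ‖b i‖) (Real.exp (δ₀ * d₀))) 0 0 Λ (B6.c1 d δ₀ (1 / 100))) BG (BG * B6.c1 d (49 / 50 * δ₀) (1 / 100) * (1 - theta363 (Fintype.card κ) 1 α₁ a₀ Cq M₂ (∑ i, ‖b i‖) (Real.exp (δ₀ * d₀)) BG Λ (B6.c1 d δ₀ (1 / 100)) * B6.c1 d (49 / 50 * δ₀) (1 / 100))⁻¹) Λ (B6.c1 d δ₀ (1 / 100)) α₁) BG BG (BG * B6.c1 d (33 / 100 * δ₀) (1 / 100) * (1 - theta363 (Fintype.card κ) 1 α₁ a₀ Cq M₂ (∑ i, ‖b i‖) (Real.exp (7 / 20 * δ₀ * d₀)) BG Λ (B6.c1 d δ₀ (1 / 100)) * B6.c1 d (33 / 100 * δ₀) (1 / 100))⁻¹) B₁ (2 * B₁ * B6.c1 d ((1 / 2 - 1 / 10) * δ₀) (1 / 10)) Λ (B6.c1 d δ₀ (1 / 100)) α₁ + ↑(Fintype.card κ)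 * kappa368Ds κQ cF (kappa385 BG (cVConc (Fintype.card κ) 1 α₁ a₀ Cq M₂ (∑ i, ‖b i‖) (Real.exp (7 / 20 * δ₀ * d₀))) 0 0 Λ (B6.c1 d δ₀ (1 / 100))) (kappa366 κQ cF (kappa385 1 (cVConc (Fintype.card κ) 1 α₁ a₀ Cq M₂ (∑ i, ‖b i‖) (Real.exp (δ₀ * d₀))) 0 0 Λ (B6.c1 d δ₀ (1 / 100))) BG (BG * B6.c1 d (49 / 50 * δ₀) (1 / 100) * (1 - theta363 (Fintype.card κ) 1 α₁ a₀ Cq M₂ (∑ i, ‖b i‖) (Real.exp (δ₀ * d₀)) BG Λ (B6.c1 d δ₀ (1 / 100)) * B6.c1 d (49 / 50 * δ₀) (1 / 100))⁻¹) Λ (B6.c1 d δ₀ (1 / 100)) α₁) BG BG BG (B6.c1 d (33 / 100 * δ₀) (1 / 100) * (1 - theta363 (Fintype.card κ) 1 α₁ a₀ Cq M₂ (∑ i, ‖b i‖) (Real.exp (7 / 20 * δ₀ * d₀)) BG Λ (B6.c1 d δ₀ (1 / 100)) * B6.c1 d (33 / 100 * δ₀) (1 / 100))⁻¹) (BG *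 Λρ₁ ^ 2 * B6.c1 d (33 / 100 * δ₀) (1 / 100) * (1 - thetaL363 (Fintype.card κ) 1 α₁ a₀ Cq M₂ (∑ i, ‖b i‖) (Real.exp (7 / 20 * δ₀ * d₀)) BG Λ (B6.c1 d δ₀ (1 / 100)) * B6.c1 d (33 / 100 * δ₀) (1 / 100))⁻¹) B₁ (2 * B₁ * B6.c1 d ((1 / 2 - 1 / 10) * δ₀) (1 / 10)) (cBConc (Fintype.card κ) M₂ (∑ i, ‖b i‖) (Real.exp (B9Ineq368Vprime.rateC (1 / 100) (33 / 100 * δ₀) * d₀))) (cCConc (Fintype.card κ) 1 α₁ a₀ Cq M₂ (∑ i, ‖b i‖) (Real.exp (B9Ineq368Vprime.rateC (1 / 100) (33 / 100 * δ₀) * d₀))) Λ (B6.c1 d δ₀ (1 / 100)) α₁) Λ (B6.c1 d δ₀ (1 / 100)) α₁) (kappa383 κQb cFb abar Λ (B6.c1 d δ₀ (1 / 100)) α₁) Λ (B6.c1 d δ₀ (1 / 100)) * α₁ * B6.c1 d (9 / 50 * δ₀) (1 / 100) < 1 / 2 :=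
    hF4 α₁ (by rw [habs]; linarith only [hα₁1, hmε₄, hε₄])
  have h5 : α₁ * (2 * (kappa366 κQ cF (kappa385 1 (cVConc (Fintype.card κ) 1 α₁ a₀ Cq M₂ (∑ i, ‖b i‖) (Real.exp (δ₀ * d₀))) 0 0 Λ (B6.c1 d δ₀ (1 / 100))) BG (BG * B6.c1 d (49 / 50 * δ₀) (1 / 100) * (1 - theta363 (Fintype.card κ) 1 α₁ a₀ Cq M₂ (∑ i, ‖b i‖) (Real.exp (δ₀ * d₀)) BG Λ (B6.c1 d δ₀ (1 / 100)) * B6.c1 d (49 / 50 * δ₀) (1 / 100))⁻¹) Λ (B6.c1 d δ₀ (1 / 100)) α₁ * B₁ * c₄ * B6.c1 d δ₀ (1 / 2 + 1 / 10)) * B6.c1 d ((1 / 2 - 1 / 10) * δ₀) (1 / 10)) < 1 / 2 :=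
    hF5 α₁ (by rw [habs]; linarith only [hα₁1, hmε₅, hε₅])
  have hhalf : (1 / 2 : ℝ) < 1 := by norm_num
  -- `η·α₁(Lʲη)⁻¹ ≦ 1/4` from `α₁ ≦ 1/4` and `η ≦ Lʲη`
  have hsmall : ∀ y : g.Site, g.eta * (α₁ * (g.len y)⁻¹) ≤ 1 / 4 := fun y => by
    have hq : g.eta * (g.len y)⁻¹ ≤ 1 := by
      rw [← div_eq_mul_inv]; exact (div_le_one (hlen y)).mpr (hlenη y)
    calc g.eta * (α₁ * (g.len y)⁻¹) = α₁ * (g.eta * (g.len y)⁻¹) := by ring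
      _ ≤ α₁ * 1 := mul_le_mul_of_nonneg_left hq hα₁0
      _ ≤ 1 / 4 := by linarith only [hα₁1, hmh]
  -- `P₂`'s (3.83) from the (3.15)/(3.80)–(3.81) letters (`B9Ineq385VG.ineq383_op`), delivered at the rate `δ = δ₀/5`
  have hP₂ : HasMajorant (g := toB6 g Rr H) (fun q : (κ × S) × ι => blk q.1.2) P₂
      (fun a a' => kappa383 κQb cFb abar Λ (B6.c1 d δ₀ (1 / 100)) α₁ * α₁ * (g.len a ^ 2)⁻¹ *
        Real.exp (-(1 / 5 * δ₀ * g.dist a a'))) := by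
    rw [hP₂def]
    exact ineq383_op (R := Rr) (H := H) (fun q : (κ × S) × ι => blk q.1.2) d δ₀ δ₀ (1 / 100) (1 / 100) (1 / 5 * δ₀) Λ κQb cFb
      abar α₁ hκQb hcFb habar hα₁0 hΛ0.le hδ5 (by norm_num) (by norm_num) hδ₀.le hrb hdnn htri h261β hT2i
      hQb hQsb hF₂ hF₂s ha324
  -- Theorem 3.3's entries for `G(U)` weakened from the rate `δ₀` to `δ = δ₀/5`
  have hexpδ : ∀ a a' : g.Site, Real.exp (-(δ₀ * g.dist a a')) ≤ Real.exp (-(1 / 5 * δ₀ * g.dist a a')) := fun a a' => by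
    have h0 : 0 ≤ δ₀ * g.dist a a' := mul_nonneg hδ₀.le (hdnn a a')
    exact Real.exp_le_exp.mpr (by linarith only [h0])
  have hGδ : HasMajorant (g := toB6 g Rr H) (fun q : (κ × S) × ι => blk q.1.2) G
      (fun a a' => B₀ * g.len a ^ 2 * Real.exp (-(1 / 5 * δ₀ * g.dist a a'))) :=
    hasMajorant_mono (g := toB6 g Rr H) _ hG fun a a' =>
      mul_le_mul_of_nonneg_left (hexpδ a a') (mul_nonneg hB₀ (sq_nonneg _))
  have hDGδ : ∀ k : κ ⊕ κ, HasMajorant (g := toB6 g Rr H) (fun q : (κ × S) × ι => blk q.1.2)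
      (conj b (diffLetter (bT T) (bU U) ((g.eta : ℂ)⁻¹) k) * G) (fun a a' => B₀ * g.len a * Real.exp (-(1 / 5 * δ₀ * g.dist a a'))) :=
    fun k => hasMajorant_mono (g := toB6 g Rr H) _ (hDG k) fun a a' =>
      mul_le_mul_of_nonneg_left (hexpδ a a') (mul_nonneg hB₀ (hlen a).le)
  have hGDδ : ∀ k : κ ⊕ κ, HasMajorant (g := toB6 g Rr H) (fun q : (κ × S) × ι => blk q.1.2)
      (G * conj b (diffLetter (bT T) (bU U) ((g.eta : ℂ)⁻¹) k)) (fun a a' => B₀ * g.len a * Real.exp (-(1 / 5 * δ₀ * g.dist a a'))) :=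
    fun k => hasMajorant_mono (g := toB6 g Rr H) _ (hGD k) fun a a' =>
      mul_le_mul_of_nonneg_left (hexpδ a a') (mul_nonneg hB₀ (hlen a).le)
  -- signs of the explicit constants at this `α₁`
  have hκ₂0 : 0 ≤ kappa383 κQb cFb abar Λ (B6.c1 d δ₀ (1 / 100)) α₁ := kappa383_nonneg hκQb hcFb habar hΛ0.le hc₂.le hα₁0
  have hcV0E : ∀ E : ℝ, 0 ≤ E →
      0 ≤ kappa385 1 (cVConc (Fintype.card κ) 1 α₁ a₀ Cq M₂ (∑ i, ‖b i‖) E) 0 0 Λ (B6.c1 d δ₀ (1 / 100)) := fun E hE =>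
    kappa385_nonneg zero_le_one (cVConc_nonneg hα₁0 ha₀ hCq hM₂ hSb hE) le_rfl le_rfl hΛ0.le hc₂.le
  have hcV0G : 0 ≤ kappa385 BG (cVConc (Fintype.card κ) 1 α₁ a₀ Cq M₂ (∑ i, ‖b i‖) (Real.exp (7 / 20 * δ₀ * d₀))) 0 0 Λ (B6.c1 d δ₀ (1 / 100)) :=
    kappa385_nonneg hBG.le (cVConc_nonneg hα₁0 ha₀ hCq hM₂ hSb (Real.exp_nonneg _)) le_rfl le_rfl hΛ0.le hc₂.le
  have hNc : 0 < BG * B6.c1 d (49 / 50 * δ₀) (1 / 100) * (1 - theta363 (Fintype.card κ) 1 α₁ a₀ Cq M₂ (∑ i, ‖b i‖) (Real.exp (δ₀ * d₀)) BG Λ (B6.c1 d δ₀ (1 / 100)) * B6.c1 d (49 / 50 * δ₀) (1 / 100))⁻¹ :=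
    mul_pos (mul_pos hBG hcc') (inv_pos.mpr (by linarith only [h1]))
  have hN'' : 0 ≤ BG * B6.c1 d (33 / 100 * δ₀) (1 / 100) * (1 - theta363 (Fintype.card κ) 1 α₁ a₀ Cq M₂ (∑ i, ‖b i‖) (Real.exp (7 / 20 * δ₀ * d₀)) BG Λ (B6.c1 d δ₀ (1 / 100)) * B6.c1 d (33 / 100 * δ₀) (1 / 100))⁻¹ :=
    mul_nonneg (mul_nonneg hBG.le hc''.le) (inv_nonneg.mpr (by linarith only [h2]))
  have hN3 : 0 ≤ B6.c1 d (33 / 100 * δ₀) (1 / 100) * (1 - theta363 (Fintype.card κ) 1 α₁ a₀ Cq M₂ (∑ i, ‖b i‖) (Real.exp (7 / 20 * δ₀ * d₀)) BG Λ (B6.c1 d δ₀ (1 / 100)) * B6.c1 d (33 / 100 * δ₀) (1 / 100))⁻¹ :=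
    mul_nonneg hc''.le (inv_nonneg.mpr (by linarith only [h2]))
  have hN3L : 0 ≤ BG * Λρ₁ ^ 2 * B6.c1 d (33 / 100 * δ₀) (1 / 100) * (1 - thetaL363 (Fintype.card κ) 1 α₁ a₀ Cq M₂ (∑ i, ‖b i‖) (Real.exp (7 / 20 * δ₀ * d₀)) BG Λ (B6.c1 d δ₀ (1 / 100)) * B6.c1 d (33 / 100 * δ₀) (1 / 100))⁻¹ :=
    mul_nonneg (mul_nonneg (mul_nonneg hBG.le (sq_nonneg Λρ₁)) hc''.le) (inv_nonneg.mpr (by linarith only [h3]))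
  have hκC0 : 0 < kappa366 κQ cF (kappa385 1 (cVConc (Fintype.card κ) 1 α₁ a₀ Cq M₂ (∑ i, ‖b i‖) (Real.exp (δ₀ * d₀))) 0 0 Λ (B6.c1 d δ₀ (1 / 100))) BG (BG * B6.c1 d (49 / 50 * δ₀) (1 / 100) * (1 - theta363 (Fintype.card κ) 1 α₁ a₀ Cq M₂ (∑ i, ‖b i‖) (Real.exp (δ₀ * d₀)) BG Λ (B6.c1 d δ₀ (1 / 100)) * B6.c1 d (49 / 50 * δ₀) (1 / 100))⁻¹) Λ (B6.c1 d δ₀ (1 / 100)) α₁ :=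
    kappa366_pos hκQ hcF (hcV0E _ (Real.exp_nonneg _)) hNc hΛ0 hc₂ hα₁0
  have hBc0 : 0 ≤ 2 * B₁ * B6.c1 d ((1 / 2 - 1 / 10) * δ₀) (1 / 10) := mul_nonneg (mul_nonneg zero_le_two hB₁.le) hc₁v'.le
  have hK1nn : 0 ≤ kappa368 κQ cF (kappa385 1 (cVConc (Fintype.card κ) 1 α₁ a₀ Cq M₂ (∑ i, ‖b i‖) (Real.exp (7 / 20 * δ₀ * d₀))) 0 0 Λ (B6.c1 d δ₀ (1 / 100))) (kappa366 κQ cF (kappa385 1 (cVConc (Fintype.card κ) 1 α₁ a₀ Cq M₂ (∑ i, ‖b i‖) (Real.exp (δ₀ * d₀))) 0 0 Λ (B6.c1 d δ₀ (1 / 100))) BG (BG * B6.c1 d (49 / 50 * δ₀) (1 / 100) * (1 - theta363 (Fintype.card κ) 1 α₁ a₀ Cq M₂ (∑ i, ‖b i‖) (Real.exp (δ₀ * d₀)) BG Λ (B6.c1 d δ₀ (1 / 100)) * B6.c1 d (49 / 50 * δ₀) (1 / 100))⁻¹) Λ (B6.c1 d δ₀ (1 / 100)) α₁) BG BG (BG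 * B6.c1 d (33 / 100 * δ₀) (1 / 100) * (1 - theta363 (Fintype.card κ) 1 α₁ a₀ Cq M₂ (∑ i, ‖b i‖) (Real.exp (7 / 20 * δ₀ * d₀)) BG Λ (B6.c1 d δ₀ (1 / 100)) * B6.c1 d (33 / 100 * δ₀) (1 / 100))⁻¹) B₁ (2 * B₁ * B6.c1 d ((1 / 2 - 1 / 10) * δ₀) (1 / 10)) Λ (B6.c1 d δ₀ (1 / 100)) α₁ :=
    kappa368_nonneg hκQ.le hcF.le (hcV0E _ (Real.exp_nonneg _)) hκC0.le hBG.le hBG.le hN'' hB₁.le hBc0 hc₂.le hα₁0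
  have hcB : 0 ≤ cBConc (Fintype.card κ) M₂ (∑ i, ‖b i‖) (Real.exp (B9Ineq368Vprime.rateC (1 / 100) (33 / 100 * δ₀) * d₀)) := by
    unfold cBConc
    exact mul_nonneg (mul_nonneg zero_le_two (Nat.cast_nonneg _))
      (mul_nonneg (mul_nonneg (mul_nonneg zero_le_two hM₂) hSb) (Real.exp_nonneg _))
  have hcC : 0 ≤ cCConc (Fintype.card κ) 1 α₁ a₀ Cq M₂ (∑ i, ‖b i‖)
      (Real.exp (B9Ineq368Vprime.rateC (1 / 100) (33 / 100 * δ₀) * d₀)) := by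
    unfold cCConc
    have i0 : 0 ≤ 2 + Cq * α₁ := by have := mul_nonneg hCq hα₁0; linarith only [this]
    have i1 : 0 ≤ (2 + 8 * (1 : ℝ) ^ 2 * α₁) * (Fintype.card κ : ℝ) := mul_nonneg (by linarith only [hα₁0]) (Nat.cast_nonneg _)
    have i2 : 0 ≤ a₀ * Cq * (2 + Cq * α₁) := mul_nonneg (mul_nonneg ha₀ hCq) i0
    have i3 : 0 ≤ 4 * (Fintype.card κ : ℝ) * (1 : ℝ) ^ 2 := by positivity
    exact mul_nonneg (mul_nonneg (mul_nonneg (add_nonneg (add_nonneg i1 i2) i3) hM₂) hSb) (Real.exp_nonneg _)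
  have hK3nn : 0 ≤ ↑(Fintype.card κ) * kappa368Ds κQ cF (kappa385 BG (cVConc (Fintype.card κ) 1 α₁ a₀ Cq M₂ (∑ i, ‖b i‖) (Real.exp (7 / 20 * δ₀ * d₀))) 0 0 Λ (B6.c1 d δ₀ (1 / 100))) (kappa366 κQ cF (kappa385 1 (cVConc (Fintype.card κ) 1 α₁ a₀ Cq M₂ (∑ i, ‖b i‖) (Real.exp (δ₀ * d₀))) 0 0 Λ (B6.c1 d δ₀ (1 / 100))) BG (BG * B6.c1 d (49 / 50 * δ₀) (1 / 100) * (1 - theta363 (Fintype.card κ) 1 α₁ a₀ Cq M₂ (∑ i, ‖b i‖) (Real.exp (δ₀ * d₀)) BG Λ (B6.c1 d δ₀ (1 / 100)) * B6.c1 d (49 / 50 * δ₀) (1 / 100))⁻¹) Λ (B6.c1 d δ₀ (1 / 100)) α₁) BG BG BG (B6.c1 d (33 / 100 * δ₀) (1 / 100) * (1 - theta363 (Fintype.card κ) 1 α₁ a₀ Cq M₂ (∑ i, ‖b i‖) (Real.exp (7 / 20 * δ₀ * d₀)) BG Λ (B6.c1 d δ₀ (1 / 100)) * B6.c1 d (33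 / 100 * δ₀) (1 / 100))⁻¹) (BG * Λρ₁ ^ 2 * B6.c1 d (33 / 100 * δ₀) (1 / 100) * (1 - thetaL363 (Fintype.card κ) 1 α₁ a₀ Cq M₂ (∑ i, ‖b i‖) (Real.exp (7 / 20 * δ₀ * d₀)) BG Λ (B6.c1 d δ₀ (1 / 100)) * B6.c1 d (33 / 100 * δ₀) (1 / 100))⁻¹) B₁ (2 * B₁ * B6.c1 d ((1 / 2 - 1 / 10) * δ₀) (1 / 10)) (cBConc (Fintype.card κ) M₂ (∑ i, ‖b i‖) (Real.exp (B9Ineq368Vprime.rateC (1 / 100) (33 / 100 * δ₀) * d₀))) (cCConc (Fintype.card κ) 1 α₁ a₀ Cq M₂ (∑ i, ‖b i‖) (Real.exp (B9Ineq368Vprime.rateC (1 / 100) (33 / 100 * δ₀) * d₀))) Λ (B6.c1 d δ₀ (1 / 100)) α₁ :=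
    mul_nonneg (Nat.cast_nonneg _) (kappa368Ds_nonneg hκQ.le hcF.le hcV0G hκC0.le hBG.le hBG.le hBG.le hN3 hN3L hB₁.le hBc0
      hcB hcC hc₂.le hα₁0)
  have hXpos : 0 < 2 * (kappa366 κQ cF (kappa385 1 (cVConc (Fintype.card κ) 1 α₁ a₀ Cq M₂ (∑ i, ‖b i‖) (Real.exp (δ₀ * d₀))) 0 0 Λ (B6.c1 d δ₀ (1 / 100))) BG (BG * B6.c1 d (49 / 50 * δ₀) (1 / 100) * (1 - theta363 (Fintype.card κ) 1 α₁ a₀ Cq M₂ (∑ i, ‖b i‖) (Real.exp (δ₀ * d₀)) BG Λ (B6.c1 d δ₀ (1 / 100)) * B6.c1 d (49 / 50 * δ₀) (1 / 100))⁻¹) Λ (B6.c1 d δ₀ (1 / 100)) α₁ * B₁ * c₄ * B6.c1 d δ₀ (1 / 2 + 1 / 10)) * B6.c1 d ((1 / 2 - 1 / 10) * δ₀) (1 / 10) :=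
    mul_pos (mul_pos two_pos (mul_pos (mul_pos (mul_pos hκC0 hB₁) hc₄) hc₁v)) hc₁v'
  have ha₁' : α₁ ≤ (2 * (kappa366 κQ cF (kappa385 1 (cVConc (Fintype.card κ) 1 α₁ a₀ Cq M₂ (∑ i, ‖b i‖) (Real.exp (δ₀ * d₀))) 0 0 Λ (B6.c1 d δ₀ (1 / 100))) BG (BG * B6.c1 d (49 / 50 * δ₀) (1 / 100) * (1 - theta363 (Fintype.card κ) 1 α₁ a₀ Cq M₂ (∑ i, ‖b i‖) (Real.exp (δ₀ * d₀)) BG Λ (B6.c1 d δ₀ (1 / 100)) * B6.c1 d (49 / 50 * δ₀) (1 / 100))⁻¹) Λ (B6.c1 d δ₀ (1 / 100)) α₁ * B₁ * c₄ * B6.c1 d δ₀ (1 / 2 + 1 / 10)) * B6.c1 d ((1 / 2 - 1 / 10) * δ₀) (1 / 10))⁻¹ := by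
    rw [inv_eq_one_div, le_div_iff₀ hXpos]; linarith only [h5]
  -- FILE 19 with the cascade, the explicit constants and the thresholds
  obtain ⟨Tinv, GExt, e1, e2, e3, e4, hLc, hRc⟩ := thm34_G_clause_concreteC (Rr := Rr) (H := H) b T U blk d
    δ₀ (1 / 5 * δ₀) (1 / 4 * δ₀) (7 / 20 * δ₀) δ₀ (49 / 50 * δ₀) (1 / 100) (1 / 10) (1 / 10) c₄ (1 / 100) (1 / 100) (9 / 50 * δ₀)
    (1 / 100) (33 / 100 * δ₀) (1 / 100) Λ Λρ Λρ₁ B₀ κQ BG B₁ _ _ cF Cq a₀ _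
    (kappa368 κQ cF (kappa385 1 (cVConc (Fintype.card κ) 1 α₁ a₀ Cq M₂ (∑ i, ‖b i‖) (Real.exp (7 / 20 * δ₀ * d₀))) 0 0 Λ (B6.c1 d δ₀ (1 / 100))) (kappa366 κQ cF (kappa385 1 (cVConc (Fintype.card κ) 1 α₁ a₀ Cq M₂ (∑ i, ‖b i‖) (Real.exp (δ₀ * d₀))) 0 0 Λ (B6.c1 d δ₀ (1 / 100))) BG (BG * B6.c1 d (49 / 50 * δ₀) (1 / 100) * (1 - theta363 (Fintype.card κ) 1 α₁ a₀ Cq M₂ (∑ i, ‖b i‖) (Real.exp (δ₀ * d₀)) BG Λ (B6.c1 d δ₀ (1 / 100)) * B6.c1 d (49 / 50 * δ₀) (1 / 100))⁻¹) Λ (B6.c1 d δ₀ (1 / 100)) α₁) BG BG (BG * B6.c1 d (33 / 100 * δ₀) (1 / 100) * (1 - theta363 (Fintype.card κ) 1 α₁ a₀ Cq M₂ (∑ i, ‖b i‖) (Real.exp (7 / 20 * δ₀ * d₀)) BG Λ (B6.c1 d δ₀ (1 / 100)) * B6.c1 d (33 / 100 * δ₀) (1 / 100))⁻¹) B₁ (2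 * B₁ * B6.c1 d ((1 / 2 - 1 / 10) * δ₀) (1 / 10)) Λ (B6.c1 d δ₀ (1 / 100)) α₁ + ↑(Fintype.card κ) * kappa368Ds κQ cF (kappa385 BG (cVConc (Fintype.card κ) 1 α₁ a₀ Cq M₂ (∑ i, ‖b i‖) (Real.exp (7 / 20 * δ₀ * d₀))) 0 0 Λ (B6.c1 d δ₀ (1 / 100))) (kappa366 κQ cF (kappa385 1 (cVConc (Fintype.card κ) 1 α₁ a₀ Cq M₂ (∑ i, ‖b i‖) (Real.exp (δ₀ * d₀))) 0 0 Λ (B6.c1 d δ₀ (1 / 100))) BG (BG * B6.c1 d (49 / 50 * δ₀) (1 / 100) * (1 - theta363 (Fintype.card κ) 1 α₁ a₀ Cq M₂ (∑ i, ‖b i‖) (Real.exp (δ₀ * d₀)) BG Λ (B6.c1 d δ₀ (1 / 100)) * B6.c1 d (49 / 50 * δ₀) (1 / 100))⁻¹) Λ (B6.c1 d δ₀ (1 / 100)) α₁) BG BG BG (B6.c1 d (33 / 100 * δ₀) (1 / 100) * (1 - theta363 (Fintype.card κ) 1 α₁ a₀ Cq M₂ (∑ i, ‖b i‖) (Real.exp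 (7 / 20 * δ₀ * d₀)) BG Λ (B6.c1 d δ₀ (1 / 100)) * B6.c1 d (33 / 100 * δ₀) (1 / 100))⁻¹) (BG * Λρ₁ ^ 2 * B6.c1 d (33 / 100 * δ₀) (1 / 100) * (1 - thetaL363 (Fintype.card κ) 1 α₁ a₀ Cq M₂ (∑ i, ‖b i‖) (Real.exp (7 / 20 * δ₀ * d₀)) BG Λ (B6.c1 d δ₀ (1 / 100)) * B6.c1 d (33 / 100 * δ₀) (1 / 100))⁻¹) B₁ (2 * B₁ * B6.c1 d ((1 / 2 - 1 / 10) * δ₀) (1 / 10)) (cBConc (Fintype.card κ) M₂ (∑ i, ‖b i‖) (Real.exp (B9Ineq368Vprime.rateC (1 / 100) (33 / 100 * δ₀) * d₀))) (cCConc (Fintype.card κ) 1 α₁ a₀ Cq M₂ (∑ i, ‖b i‖) (Real.exp (B9Ineq368Vprime.rateC (1 / 100) (33 / 100 * δ₀) * d₀))) Λ (B6.c1 d δ₀ (1 / 100)) α₁)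
    _ (kappa383 κQb cFb abar Λ (B6.c1 d δ₀ (1 / 100)) α₁) α₁ C₀ d₀ M₂ kQ kF sQ sF cfun w
    hB₀ hκQ hBG hB₁ hcF hCq ha₀ (add_nonneg hK1nn hK3nn) hκ₂0 hα₁0 hC₀ hΛ hΛρ hρ0 (by norm_num) (by norm_num) hδ₀
    hδ5 hM₂ hr hrP hrG hr1 (by norm_num) (by norm_num) hρ₁0 hα''ρ hα''ρ2 hα''ρ3 hΛρ₁
    hr368 hrc1 hρc0 (by norm_num) (by norm_num) hrc hrcG hGδ1 hGδ1 (by norm_num) (by norm_num) (by norm_num) hc₄ hrCinv hc₁v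
    hc₁v' hc₂ hcc' rfl rfl ha₁' rfl (by norm_num) hα'ρ0 hα'ρ2 rfl hdnn htri hrefl hsym hlen h261β h261' h261''
    h261c h261v h261v' hT1 hT2 hT1i hT2i hT4 hTρ hTρ₁ hT4v (h4.trans hhalf) hrepr hη hL A hT hsmall hU1 h337B h337F h337B' h337Bτ
    h337FB hA hAτB hAτF hAFB hAst hAloc hdAst h35 hd₀B hd₀F hd₀FB hd₀st hd₀loc hd₀0 h342_1 h342_2 h342_3 rep hrep h357 h357s
    hQc hQcs hFc hFcs hLinv h348 (h1.trans hhalf) hw hcard hkQ hkF hsQ hsF hcfun (h2.trans hhalf) (h3.trans hhalf)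
    (le_add_of_nonneg_right hK3nn) (le_add_of_nonneg_left hK1nn) h380 h380s hP₂def hΔG hGΔ hP₂ hGδ hDGδ hGDδ
  -- the conclusions, with the output majorants weakened to the `α₁`-free constant `B` and the rate `δ₀/6`
  refine ⟨Tinv, GExt, e1, e2, e3, e4, fun X P hP0 hXG => ?_, fun Y hGY => ?_⟩
  · have hXGδ : HasMajorant (g := toB6 g Rr H) (fun q : (κ × S) × ι => blk q.1.2) (X * G)
        (fun a a' => B₀ * P a * Real.exp (-(1 / 5 * δ₀ * g.dist a a'))) :=
      hasMajorant_mono (g := toB6 g Rr H) _ hXG fun a a' => mul_le_mul_of_nonneg_left (hexpδ a a') (mul_nonneg hB₀ (hP0 a))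
    refine hasMajorant_mono (g := toB6 g Rr H) _ (hLc X P hP0 hXGδ) fun a a' => ?_
    have h0 : 0 ≤ δ₀ * g.dist a a' := mul_nonneg hδ₀.le (hdnn a a')
    have hexp6 : Real.exp (-((1 - 1 / 100) * (9 / 50 * δ₀) * g.dist a a')) ≤ Real.exp (-(δ₀ / 6 * g.dist a a')) :=
      Real.exp_le_exp.mpr (by linarith only [h0])
    exact mul_le_mul (mul_le_mul_of_nonneg_right ((mul_le_mul_of_nonneg_left (neumann_le_two h4) hB₀c).trans hB2) (hP0 a))
      hexp6 (Real.exp_pos _).le (mul_nonneg hBnn (hP0 a))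
  · have hGYδ : HasMajorant (g := toB6 g Rr H) (fun q : (κ × S) × ι => blk q.1.2) (G * Y)
        (fun a a' => B₀ * g.len a * Real.exp (-(1 / 5 * δ₀ * g.dist a a'))) :=
      hasMajorant_mono (g := toB6 g Rr H) _ hGY fun a a' => mul_le_mul_of_nonneg_left (hexpδ a a') (mul_nonneg hB₀ (hlen a).le)
    refine hasMajorant_mono (g := toB6 g Rr H) _ (hRc Y hGYδ) fun a a' => ?_
    have h0 : 0 ≤ δ₀ * g.dist a a' := mul_nonneg hδ₀.le (hdnn a a')
    have hexp6 : Real.exp (-((1 - 3 * (1 / 100)) * (9 / 50 * δ₀) * g.dist a a')) ≤ Real.exp (-(δ₀ / 6 * g.dist a a')) :=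
      Real.exp_le_exp.mpr (by linarith only [h0])
    exact mul_le_mul (mul_le_mul_of_nonneg_right
      ((mul_le_mul_of_nonneg_left (neumann_le_two h4) (mul_nonneg (mul_nonneg hB₀ (sq_nonneg Λρ)) hc'.le)).trans hB3) (hlen a).le)
      hexp6 (Real.exp_pos _).le (mul_nonneg hBnn (hlen a).le)

end Uniform

end Literature.MathematicalPhysics.QuantumFieldTheory.Balaban1983to89.B9Thm34GUniformR1

end
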